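import Mathlib.LinearAlgebra.Matrix.GeneralLinearGroup.Defs
import Mathlib.Logic.Equiv.Fin.Basic
import Literature.Computability.AlgebraicComplexity.StandardFamilies
import HarnessLib

/-!
# Named facts: binary determinantal complexity of `per₃` and uniqueness of Grenet's `7 × 7`
representation among BINARY variable matrices (Hüttenhain–Ikenmeyer 2016, Thm. 3 and Prop. 9)

Topic `Literature/Computability/AlgebraicComplexity`. Vendored for route
ValiantsHypothesis/ProjectionStability: the fact `huttenhainIkenmeyer2016_prop9` grounds (the
`{0,1}`-constants case of) `Summit.ValiantsHypothesis.ValiantsHypothesis.Theses.ProjectionStability.UniqBase`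
(item stmt-ValiantsHypothesis-17836; = the parent route's `ProjectionRigidity.ProjOptimalUniqueThree`,
stmt-ValiantsHypothesis-16004), and `huttenhainIkenmeyer2016_thm3` is the binary companion of the
in-tree `dc(per₃) = 7` (Alper–Bogart–Velasco 2017, Cor. 1.4).

**Source.** J. Hüttenhain, C. Ikenmeyer, *Binary determinantal complexity*, Linear Algebra Appl.
504 (2016) 559–573 = arXiv:1410.8202 [HuttenhainIkenmeyer2016]. Printed statements (arXiv v2):

* §1: "We call a matrix whose entries are only zeros, ones, or variables, a *binary variable matrix*.
  … We then denote by `bdc(f)` the smallest `n` such that `f` can be written as a determinant of an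
  `n × n` binary variable matrix."
* **Theorem 3.** "`bdc(per₃) = 7`." (computer-aided: enumeration of bipartite graphs, §3; the upper
  bound is Grenet's construction, Thm. 2: "For every natural number `m` there exists an integer
  variable matrix `A` of size `2^m − 1` such that `per_m = det(A)`. Moreover, `A` can be chosen such
  that the entries in `A` are only variables, zeros, and ones".)
* §4, display (grenet7x7): Grenet's matrix for `m = 3` — transcribed below as `hiGrenet7`
  (variables `x_{ij}`, `1 ≤ i, j ≤ 3`, shifted to `Fin 3 × Fin 3`); "By means of a cluster
  computation over the course of one week, we determined all `463` binary variable matrices with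
  this property".
* **Proposition 9.** "Every `7 × 7` binary variable matrix `A` with `det(A) = per₃` is equivalent to
  the Grenet construction (grenet7x7) under the following two group actions: (1) The action of
  `{(g,h) | det(g) = det(h)} ⊆ GL₇(ℤ) × GL₇(ℤ)` on `7 × 7` matrices via left and right
  multiplication, together with transposition of `7 × 7` matrices. (2) The action of `𝔖₃ × 𝔖₃` on
  the variables `x_{ij}` with `1 ≤ i, j ≤ 3`, and the corresponding transposition (i.e. the map
  `x_{ij} ↦ x_{ji}`.) Note that (1) leaves the determinant of any `7 × 7` binary variable matrix
  invariant and (2) leaves the permanent polynomial invariant." (verified "by hand (with computer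
  support)": all `463` matrices reduce to (grenet7x7) by elementary row and column operations;
  Example 10 exhibits one such `(g, h)`.)

**Rendering.** Base ring `ℤ` (HI16's "integer variable matrices"; `per₃ = perPoly (Fin 3) ℤ`, the
tree's generic permanent `∑_π ∏_i X_{π i, i}` — invariant under (2), so the row/column convention is
immaterial). `IsBinaryVariableMatrix A`: every entry is `0`, `1` or a variable `X v`. The orbit of
(grenet7x7) under the group generated by (1) and (2): the two actions commute; (2) is the finite group
of variable substitutions `x_{ij} ↦ x_{σ i, τ j}` and `x_{ij} ↦ x_{σ j, τ i}` (`σ, τ ∈ 𝔖₃`), applied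
through `MvPolynomial.rename`; (1) together with matrix transposition is the set of maps
`M ↦ g M h`, `M ↦ g Mᵀ h` with `g, h ∈ GL₇(ℤ)`, `det g = det h` (closed under composition and
inverses), so "`A` is equivalent to `G`" is rendered as
`∃ g h σ τ (tv tm : Bool), A = g • [rename] G [ᵀ] • h` — an existential over a finite-dimensional
search space, exactly as printed. `bdc` is not introduced as a definition: Theorem 3 is stated as
"no binary variable matrix of size `n < 7` has determinant `per₃`, and one of size `7` does".
The transcription of (grenet7x7) was checked by expanding the `7 × 7` determinant symbolically
(Leibniz, exact integer arithmetic): `det hiGrenet7 = per₃` (not re-proved in Lean here; it is the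
`A := hiGrenet7` instance behind the existence clause of Thm. 3).

What is NOT claimed: nothing about matrices with constants other than `0, 1` (the route item
`UniqBase` quantifies over arbitrary complex constants and a coarser gauge group
`GL₇(ℂ)² × permSymmetrySubst × transpose` — it is STRONGER than Prop. 9 in its hypothesis domain);
nothing for `m ≥ 4` ("determining `bdc(per₄)` is currently out of reach with our methods", §1).
Nothing is asserted: both facts are `def … : Prop`; users take `(h : huttenhainIkenmeyer2016_prop9)`.

## References

* J. Hüttenhain, C. Ikenmeyer, *Binary determinantal complexity*, Linear Algebra Appl. 504 (2016)
  559–573, arXiv:1410.8202: §1 (definitions, Thms. 1–3), §4 (display (grenet7x7), Prop. 9,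
  Example 10). [HuttenhainIkenmeyer2016]
* B. Grenet, *An upper bound for the permanent versus determinant problem* (2011). [Grenet2011]
-/

noncomputable section

open Matrix MvPolynomial

namespace Literature.Computability.AlgebraicComplexity

/-- A **binary variable matrix** (Hüttenhain–Ikenmeyer 2016, §1): every entry is `0`, `1` or a
single variable. [cite: HuttenhainIkenmeyer2016, §1] -/
def IsBinaryVariableMatrix {σ : Type*} {m : Type*} (A : Matrix m m (MvPolynomial σ ℤ)) : Prop :=
  ∀ i j, A i j = 0 ∨ A i j = 1 ∨ ∃ v, A i j = X v

/-- Grenet's `7 × 7` binary variable matrix with determinant `per₃`, as printed in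
Hüttenhain–Ikenmeyer 2016, §4, display (grenet7x7) (rows
`(x₁₁ x₁₂ x₁₃ 0 0 0 0)`, `(1 0 0 x₃₂ x₃₃ 0 0)`, `(0 1 0 x₃₁ 0 x₃₃ 0)`, `(0 0 1 0 x₃₁ x₃₂ 0)`,
`(0 0 0 1 0 0 x₂₃)`, `(0 0 0 0 1 0 x₂₂)`, `(0 0 0 0 0 1 x₂₁)`), with `x_{ij} = X (i-1, j-1)`.
[cite: HuttenhainIkenmeyer2016, §4 (grenet7x7)] -/
def hiGrenet7 : Matrix (Fin 7) (Fin 7) (MvPolynomial (Fin 3 × Fin 3) ℤ) :=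
  !![X (0,0), X (0,1), X (0,2), 0, 0, 0, 0;
     1, 0, 0, X (2,1), X (2,2), 0, 0;
     0, 1, 0, X (2,0), 0, X (2,2), 0;
     0, 0, 1, 0, X (2,0), X (2,1), 0;
     0, 0, 0, 1, 0, 0, X (1,2);
     0, 0, 0, 0, 1, 0, X (1,1);
     0, 0, 0, 0, 0, 1, X (1,0)]

/-- The variable substitutions of action (2) of Hüttenhain–Ikenmeyer 2016, Prop. 9: `𝔖₃ × 𝔖₃`
acting by `x_{ij} ↦ x_{σ i, τ j}`, composed (flag `tv`) with the transposition `x_{ij} ↦ x_{ji}`.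
[cite: HuttenhainIkenmeyer2016, Prop. 9 (2)] -/
def hiVarSymm (σ τ : Equiv.Perm (Fin 3)) (tv : Bool) : Fin 3 × Fin 3 → Fin 3 × Fin 3 :=
  fun ij ↦ if tv then (σ ij.2, τ ij.1) else (σ ij.1, τ ij.2)

/-- **`A` lies in the orbit of Grenet's matrix** under the group generated by the two actions of
Hüttenhain–Ikenmeyer 2016, Prop. 9: (1) `{(g,h) ∈ GL₇(ℤ)² | det g = det h}` by left/right
multiplication together with matrix transposition (flag `tm`), (2) `𝔖₃ × 𝔖₃` and `x_{ij} ↦ x_{ji}`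
on the variables (`hiVarSymm`, through `MvPolynomial.rename`). The two actions commute and (1) with
transposition is closed under composition and inverses, so one application of each generator type
describes the whole orbit. [cite: HuttenhainIkenmeyer2016, Prop. 9] -/
def InHIGrenetOrbit (A : Matrix (Fin 7) (Fin 7) (MvPolynomial (Fin 3 × Fin 3) ℤ)) : Prop :=
  ∃ (g h : GL (Fin 7) ℤ) (σ τ : Equiv.Perm (Fin 3)) (tv tm : Bool),
    (g : Matrix (Fin 7) (Fin 7) ℤ).det = (h : Matrix (Fin 7) (Fin 7) ℤ).det ∧
    let M : Matrix (Fin 7) (Fin 7) (MvPolynomial (Fin 3 × Fin 3) ℤ) :=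
      hiGrenet7.map (rename (hiVarSymm σ τ tv))
    A = (g : Matrix (Fin 7) (Fin 7) ℤ).map C * (if tm then Mᵀ else M) * (h : Matrix (Fin 7) (Fin 7) ℤ).map C

/-- NAMED FACT (**Hüttenhain–Ikenmeyer 2016, Thm. 3**: "`bdc(per₃) = 7`"): no binary variable matrix
of size `n < 7` has determinant `per₃` (the content; lower bound `n²/2`-type arguments only give
`≥ 5`), and some binary variable matrix of size `7` does (Grenet, Thm. 2). Computer-aided proof
(§3, enumeration of bipartite graphs / `6 × 6` binary matrices with `det = ±6`). Users take
`(h : huttenhainIkenmeyer2016_thm3)`. [cite: HuttenhainIkenmeyer2016, Thm. 3] -/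
def huttenhainIkenmeyer2016_thm3 : Prop :=
  (∀ n : ℕ, n < 7 → ∀ A : Matrix (Fin n) (Fin n) (MvPolynomial (Fin 3 × Fin 3) ℤ),
      IsBinaryVariableMatrix A → A.det ≠ perPoly (Fin 3) ℤ) ∧
    ∃ A : Matrix (Fin 7) (Fin 7) (MvPolynomial (Fin 3 × Fin 3) ℤ),
      IsBinaryVariableMatrix A ∧ A.det = perPoly (Fin 3) ℤ

/-- NAMED FACT (**Hüttenhain–Ikenmeyer 2016, Prop. 9** — uniqueness of Grenet's construction in the
`7 × 7` binary case): "Every `7 × 7` binary variable matrix `A` with `det(A) = per₃` is equivalent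
to the Grenet construction (grenet7x7) under the following two group actions: (1) the action of
`{(g,h) | det(g) = det(h)} ⊆ GL₇(ℤ) × GL₇(ℤ)` on `7 × 7` matrices via left and right
multiplication, together with transposition of `7 × 7` matrices; (2) the action of `𝔖₃ × 𝔖₃` on the
variables `x_{ij}`, and the corresponding transposition `x_{ij} ↦ x_{ji}`." (All `463` such matrices,
found by a one-week cluster enumeration, were reduced to (grenet7x7) by elementary row and column
operations "by hand (with computer support)"; Example 10.) This is the `{0,1}`-constants case of the
route item `ProjectionStability.UniqBase` / `ProjectionRigidity.ProjOptimalUniqueThree`, which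
quantify over arbitrary complex constants (STRONGER than print). Users take
`(h : huttenhainIkenmeyer2016_prop9)`. [cite: HuttenhainIkenmeyer2016, Prop. 9] -/
def huttenhainIkenmeyer2016_prop9 : Prop :=
  ∀ A : Matrix (Fin 7) (Fin 7) (MvPolynomial (Fin 3 × Fin 3) ℤ),
    IsBinaryVariableMatrix A → A.det = perPoly (Fin 3) ℤ → InHIGrenetOrbit A

/-! ### API (trivial unfoldings) -/

/-- Grenet's matrix is a binary variable matrix. [cite: HuttenhainIkenmeyer2016, §4] -/
theorem isBinaryVariableMatrix_hiGrenet7 : IsBinaryVariableMatrix hiGrenet7 := by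
  intro i j
  fin_cases i <;> fin_cases j <;> simp [hiGrenet7]

/-- Grenet's matrix lies in its own orbit (`g = h = 1`, trivial variable symmetry).
[cite: HuttenhainIkenmeyer2016, Prop. 9] -/
theorem inHIGrenetOrbit_hiGrenet7 : InHIGrenetOrbit hiGrenet7 := by
  refine ⟨1, 1, 1, 1, false, false, rfl, ?_⟩
  have hid : hiVarSymm 1 1 false = id := by
    funext ij; simp [hiVarSymm]
  simp only [hid, Units.val_one, Bool.false_eq_true, ↓reduceIte]
  rw [MvPolynomial.rename_id]
  simp [Matrix.map_id]

end Literature.Computability.AlgebraicComplexity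

end
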